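import Literature.Analysis.FluidPDE.TorusLinearisedNSVorticity
import Literature.Analysis.FluidPDE.SawtoothCascadeSmooth
import HarnessLib

/-!
# The vorticity of the linearised response along the sawtooth pulse cascade: on each half-slot it
# is fed only by the cross-stream component of the response on the curvature collars of the profile

Proofs-layer sequel of `SawtoothCascade.lean` / `TorusLinearisedNSVorticity.lean` (cell `ad-ideate`, route
SawtoothPulseCascade; theorems only, no definitions, no named facts). The cascade carrier on an H half-slot
of phase `j` is the planar shear `ū(t, x) = rateH j t · U_j(x₂) e₁` (`CascadeParams.field_eq_of_mem_H`),
on a V half-slot `ū = rateV j t · U_j(x₁) e₂`. For such a carrier the background vorticity is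
`Ω̄ = ∂₀ū₁ − ∂₁ū₀ = −rateH · U_j′(x₂)` (resp. `+rateV · U_j′(x₁)`), its gradient
`∇Ω̄ = −rateH · U_j″(x₂) e₂` (resp. `rateV · U_j″(x₁) e₁`) lives on the curvature set of the rounded
sawtooth, and the planar linearised vorticity equation of `TorusLinearisedNSVorticity`
(Shvydkoy–Latushkin 2005, §2: `∂ₜω + ū·∇ω = νΔω − w·∇Ω̄ (+ curl g)`) has the source
`rateH · U_j″(x₂) · w₂` (resp. `−rateV · U_j″(x₁) · w₁`): ONLY THE CROSS-STREAM COMPONENT of the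
response, weighted by the profile curvature, feeds the response vorticity — the linear, planar, viscous
form of "vorticity is generated at the corners of the zig-zag" (Elgindi–Liss–Mattingly 2025, §1.2.2 /
§3.1: the hyperbolic pulse pair acts through `H_α′ = ±α`, the corners carry `H_α″`).

* `SawtoothCascade.isContDiff_coordFun`, `…gradient_coordFun` — calculus of smooth `1`-periodic profiles
  read on one torus coordinate (`x ↦ ψ(repr x k)`): `∇(ψ ∘ xₖ) = ψ′(xₖ) eₖ`;
* `CascadeParams.torusVorticityTensor_field_of_mem_H/_V` — `Ω̄` on the half-slots;
  `CascadeParams.gradient_vorticity_field_of_mem_H/_V` — `∇Ω̄ = ∓ rate · U_j″ · e`;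
  `CascadeParams.norm_gradient_vorticity_field_le_of_mem_H/_V` — `‖∇Ω̄‖ ≤ rate · K` whenever
  `|U_j″| ≤ K` (the curvature cap `K` is a HYPOTHESIS here; `K ≍ N_j/δ_j` for the Gaussian-rounded
  profile is not proved in this file);
* `CascadeParams.neg_inner_gradient_vorticity_field_of_mem_H/_V` — the source is `± rate·U_j″·w_cross`;
* **`CascadeParams.abs_responseVorticity_le_of_mem_H/_V`** — for every classical divergence-free solution
  `(w, q)` of the (forced) Navier–Stokes equations linearised at the cascade carrier on a window
  `[a, b]` inside one half-slot (the solution class of `K2PhaseGrowthClassical` /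
  `K2LipschitzGrowthClassical`, with a force `g`), every `ν ≥ 0`:
  `|ω_w(t, x)| ≤ sup|ω_w(a, ·)| + ∫ₐᵗ (C_g(τ) + rate_j(τ) · K · M(τ)) dτ`, where `|curl g(τ, ·)| ≤ C_g(τ)`
  and `|w_cross(τ, ·)| ≤ M(τ)` — the planar vorticity maximum principle with source
  (`Torus.linearisedNSForced_abs_vorticity_le_fin_two`); unforced forms `…_of_mem_H₀/_V₀`;
* **`CascadeParams.sqrt_integral_responseVorticity_sq_le_of_mem_H₀/_V₀`** — the enstrophy form
  `‖ω_w(t)‖₂ ≤ ‖ω_w(a)‖₂ + K ∫ₐᵗ rate_j(τ) ‖w(τ)‖₂ dτ` (unforced), i.e. the response's enstrophy is fed by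
  its `L²` size (K2″) at rate `K · rate_j` (`Torus.linearisedNSForced_sqrt_integral_vorticity_sq_le_fin_two`).

Reading (items K2″ 19696 / K2Lip = S0 of ApproxSol58 19688): with `∫ rate_j = γ` per half-slot these say
`sup|ω_w|` grows per half-slot by at most `γ · K_j · sup|w_cross|` and `‖ω_w‖₂` by `γ · K_j · sup_τ‖w‖₂`,
`K_j = sup|U_j″|` — the kernel form of the lead's "honest localisation scale `N_j/δ_j`" entry
(CENSUS-ApproxSol58-g3 §1, row 3), at the level of VORTICITY; the Biot–Savart step from `ω_w` to `∇w`
is not made here.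

## Mathlib / tree search

Tree: `Torus.partialDeriv_coordFun_self/_of_ne`, `Torus.lift_coordFun_apply` (`TorusCoordinateFunctions`),
`Torus.gradient_eq_sum_partialDeriv`, `CascadeParams.partialDeriv_field_of_mem_H/_V`, `field_eq_of_mem_H/_V`,
`isDivFree_field_of_mem_H/_V`, `rateH_nonneg`, `continuous_rateH/V`, `contDiff_U`, `U_periodic`,
`cascadeFieldSmooth`, `tStart_add_tHalf_lt_one`, `tStart_lt_one` (`SawtoothCascade*`), and the linearised
vorticity file `TorusLinearisedNSVorticity` (p491169). `lean`-grep `vorticity.*field_of_mem|responseVorticity`: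
nothing prior.

## References

* R. Shvydkoy, Y. Latushkin, J. Math. Fluid Mech. 7 (2005) 164–178, §2 (vorticity form of the linearised
  Euler operator, `curl L_vel v = L curl v`). [ShvydkoyLatushkin2005]
* T. Elgindi, K. Liss, J. Mattingly, arXiv:2304.05374, §1 (the pulsed piecewise-linear shears `H_α`, `V_α`)
  and Rmk. 1.4. [ElgindiLissMattingly2025]
* L. C. Evans, *Partial Differential Equations*, 2nd ed. 2010, §7.1.4 Thms. 8–9. [Evans2010]
-/

noncomputable section

open Set MeasureTheory
open scoped ContDiff InnerProductSpace RealInnerProductSpace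

namespace Literature.Analysis.FluidPDE.SawtoothCascade

open Literature.Analysis Literature.Analysis.FunctionSpaces Literature.Analysis.FluidPDE.Torus

/-! ### §0 Smooth periodic profiles read on one torus coordinate -/

/-- A smooth `1`-periodic profile read on the `k`-th coordinate, `x ↦ g(repr x k)`, is `C^n` on the torus
(its lift to `ℝ^d` is `y ↦ g(y k)`, `Torus.lift_coordFun_apply`). [cite: ElgindiLissMattingly2025, §1 (H_α(x₂), V_α(x₁) as fields on 𝕋²)] -/
theorem isContDiff_coordFun {d : Type*} [Fintype d] [DecidableEq d] {F : Type*} [NormedAddCommGroup F] [NormedSpace ℝ F]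
    {g : ℝ → F} (hg : Function.Periodic g 1) {n : WithTop ℕ∞} (hs : ContDiff ℝ n g) (k : d) :
    Torus.IsContDiff n (fun x : UnitAddTorus d => g (Torus.repr x k)) := by
  unfold Torus.IsContDiff
  have h : Torus.lift (fun x : UnitAddTorus d => g (Torus.repr x k)) = fun y => g (y k) :=
    funext fun y => Torus.lift_coordFun_apply hg k y
  rw [h]
  exact hs.comp ((EuclideanSpace.proj k : EuclideanSpace ℝ d →L[ℝ] ℝ).contDiff)

/-- Smooth version of `isContDiff_coordFun`. [cite: ElgindiLissMattingly2025, §1 (H_α(x₂), V_α(x₁) as fields on 𝕋²)] -/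
theorem isSmooth_coordFun {d : Type*} [Fintype d] [DecidableEq d] {F : Type*} [NormedAddCommGroup F] [NormedSpace ℝ F]
    {g : ℝ → F} (hg : Function.Periodic g 1) (hs : ContDiff ℝ ∞ g) (k : d) :
    Torus.IsSmooth (fun x : UnitAddTorus d => g (Torus.repr x k)) :=
  isContDiff_coordFun hg hs k

/-- **Gradient of a profile read on one coordinate**: `∇(ψ ∘ xₖ)(x) = ψ′(xₖ) eₖ` for a `C¹` `1`-periodic
`ψ : ℝ → ℝ` (`∂ₖ = ψ′`, `∂ᵢ = 0` for `i ≠ k`: `Torus.partialDeriv_coordFun_self/_of_ne`). [cite: ElgindiLissMattingly2025, §1 (H_α(x₂), V_α(x₁) as fields on 𝕋²)] -/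
theorem gradient_coordFun {d : Type*} [Fintype d] [DecidableEq d] {ψ : ℝ → ℝ} (hψ : Function.Periodic ψ 1)
    (hs : ContDiff ℝ 1 ψ) (k : d) (x : UnitAddTorus d) :
    Torus.gradient (fun x : UnitAddTorus d => ψ (Torus.repr x k)) x =
      deriv ψ (Torus.repr x k) • EuclideanSpace.single k (1 : ℝ) := by
  rw [Torus.gradient_eq_sum_partialDeriv (isContDiff_coordFun hψ hs k) x]
  rw [Finset.sum_eq_single k]
  · rw [Torus.partialDeriv_coordFun_self hψ k x]
  · intro i _ hik
    rw [Torus.partialDeriv_coordFun_of_ne hψ hik x, zero_smul]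
  · intro hk
    exact absurd (Finset.mem_univ k) hk

/-! ### §1 The carrier vorticity and its gradient on the half-slots -/

namespace CascadeParams

variable (P : CascadeParams)

/-- **Carrier vorticity on an H half-slot**: for `t ∈ [tStart j, tStart j + tHalf j]`,
`Ω̄(t, x) = ∂₀ū₁ − ∂₁ū₀ = −rateH j t · U_j′(x₂)` (`ū = rateH·U_j(x₂) e₁`: `∂₀ū = 0`,
`∂₁ū = rateH·U_j′(x₂) e₁`, `CascadeParams.partialDeriv_field_of_mem_H`). [cite: ElgindiLissMattingly2025, §1 (u_α = H_α(x₂) e₁ on its half period)] -/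
theorem torusVorticityTensor_field_of_mem_H {j : ℕ} {t : ℝ} (ht : t ∈ Icc (tStart j) (tStart j + tHalf j))
    (x : UnitAddTorus (Fin 2)) :
    torusVorticityTensor (P.field t) 0 1 x = -(P.rateH j t * deriv (P.U j) (Torus.repr x 1)) := by
  obtain ⟨h0, h1⟩ := P.partialDeriv_field_of_mem_H ht x
  rw [torusVorticityTensor, h0, h1]
  simp

/-- **Carrier vorticity on a V half-slot**: for `t ∈ [tStart j + tHalf j, tStart (j+1)]`,
`Ω̄(t, x) = ∂₀ū₁ − ∂₁ū₀ = rateV j t · U_j′(x₁)` (`ū = rateV·U_j(x₁) e₂`). [cite: ElgindiLissMattingly2025, §1 (u_α = V_α(x₁) e₂ on its half period)] -/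
theorem torusVorticityTensor_field_of_mem_V {j : ℕ} {t : ℝ} (ht : t ∈ Icc (tStart j + tHalf j) (tStart (j + 1)))
    (x : UnitAddTorus (Fin 2)) :
    torusVorticityTensor (P.field t) 0 1 x = P.rateV j t * deriv (P.U j) (Torus.repr x 0) := by
  obtain ⟨h1, h0⟩ := P.partialDeriv_field_of_mem_V ht x
  rw [torusVorticityTensor, h0, h1]
  simp

/-- `U_j′` is smooth and `1`-periodic (`δ j > 0`). [cite: ElgindiLissMattingly2025, §1 (H_α, V_α on 𝕋²)] -/
theorem contDiff_deriv_U {j : ℕ} (hδ : 0 < P.δ j) {n : ℕ∞} : ContDiff ℝ n (deriv (P.U j)) := by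
  have h : ContDiff ℝ ∞ (P.U j) := P.contDiff_U hδ
  have h' : ContDiff ℝ ∞ (deriv (P.U j)) := (contDiff_infty_iff_deriv.1 h).2
  exact h'.of_le (by exact_mod_cast le_top)

/-- The derivative of a `1`-periodic function is `1`-periodic. [folklore] -/
private theorem periodic_deriv {f : ℝ → ℝ} (hf : Function.Periodic f 1) : Function.Periodic (deriv f) 1 := by
  intro s
  have h : (fun y => f (y + 1)) = f := funext hf
  rw [← deriv_comp_add_const, h]

/-- `U_j′` is `1`-periodic. [cite: ElgindiLissMattingly2025, §1 (H_α, V_α on 𝕋²)] -/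
theorem deriv_U_periodic (j : ℕ) : Function.Periodic (deriv (P.U j)) 1 := periodic_deriv (P.U_periodic j)

/-- `U_j″` is `1`-periodic. [cite: ElgindiLissMattingly2025, §1 (H_α, V_α on 𝕋²)] -/
theorem deriv_deriv_U_periodic (j : ℕ) : Function.Periodic (deriv (deriv (P.U j))) 1 :=
  periodic_deriv (P.deriv_U_periodic j)

/-- **Gradient of the carrier vorticity on an H half-slot**: `∇Ω̄(t, x) = −rateH j t · U_j″(x₂) · e₂`
(`δ j > 0`; `e₂ = EuclideanSpace.single 1 1`): the curvature of the rounded sawtooth, read on the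
cross-stream coordinate. [cite: ElgindiLissMattingly2025, §1 (u_α = H_α(x₂) e₁; corners of H_α)] -/
theorem gradient_vorticity_field_of_mem_H {j : ℕ} (hδ : 0 < P.δ j) {t : ℝ}
    (ht : t ∈ Icc (tStart j) (tStart j + tHalf j)) (x : UnitAddTorus (Fin 2)) :
    Torus.gradient (torusVorticityTensor (P.field t) 0 1) x =
      -(P.rateH j t * deriv (deriv (P.U j)) (Torus.repr x 1)) • EuclideanSpace.single 1 (1 : ℝ) := by
  set ψ : ℝ → ℝ := fun s => -(P.rateH j t * deriv (P.U j) s) with hψ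
  have hfun : torusVorticityTensor (P.field t) 0 1 = fun y => ψ (Torus.repr y 1) := by
    funext y
    exact P.torusVorticityTensor_field_of_mem_H ht y
  have hψper : Function.Periodic ψ 1 := fun s => by
    simp only [hψ, P.deriv_U_periodic j s]
  have hd1 : ContDiff ℝ 1 (deriv (P.U j)) := P.contDiff_deriv_U hδ
  have hψs : ContDiff ℝ 1 ψ := (contDiff_const.mul hd1).neg
  rw [hfun, gradient_coordFun hψper hψs 1 x]
  congr 1
  have hdiff : DifferentiableAt ℝ (deriv (P.U j)) (Torus.repr x 1) :=
    (hd1.differentiable one_ne_zero).differentiableAt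
  rw [hψ]
  exact ((hdiff.hasDerivAt.const_mul (P.rateH j t)).neg).deriv

/-- **Gradient of the carrier vorticity on a V half-slot**: `∇Ω̄(t, x) = rateV j t · U_j″(x₁) · e₁`
(`δ j > 0`; `e₁ = EuclideanSpace.single 0 1`). [cite: ElgindiLissMattingly2025, §1 (u_α = V_α(x₁) e₂; corners of V_α)] -/
theorem gradient_vorticity_field_of_mem_V {j : ℕ} (hδ : 0 < P.δ j) {t : ℝ}
    (ht : t ∈ Icc (tStart j + tHalf j) (tStart (j + 1))) (x : UnitAddTorus (Fin 2)) :
    Torus.gradient (torusVorticityTensor (P.field t) 0 1) x =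
      (P.rateV j t * deriv (deriv (P.U j)) (Torus.repr x 0)) • EuclideanSpace.single 0 (1 : ℝ) := by
  set ψ : ℝ → ℝ := fun s => P.rateV j t * deriv (P.U j) s with hψ
  have hfun : torusVorticityTensor (P.field t) 0 1 = fun y => ψ (Torus.repr y 0) := by
    funext y
    exact P.torusVorticityTensor_field_of_mem_V ht y
  have hψper : Function.Periodic ψ 1 := fun s => by
    simp only [hψ, P.deriv_U_periodic j s]
  have hd1 : ContDiff ℝ 1 (deriv (P.U j)) := P.contDiff_deriv_U hδ
  have hψs : ContDiff ℝ 1 ψ := contDiff_const.mul hd1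
  rw [hfun, gradient_coordFun hψper hψs 0 x]
  congr 1
  have hdiff : DifferentiableAt ℝ (deriv (P.U j)) (Torus.repr x 0) :=
    (hd1.differentiable one_ne_zero).differentiableAt
  rw [hψ, deriv_const_mul _ hdiff]

/-- **Size of `∇Ω̄` on an H half-slot**: `‖∇Ω̄(t, x)‖ ≤ rateH j t · K` whenever `|U_j″| ≤ K`
(`γ ≥ 0`, `δ j > 0`). [cite: ElgindiLissMattingly2025, §1 (u_α = H_α(x₂) e₁; corners of H_α)] -/
theorem norm_gradient_vorticity_field_le_of_mem_H (hγ : 0 ≤ P.γ) {j : ℕ} (hδ : 0 < P.δ j) {t : ℝ}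
    (ht : t ∈ Icc (tStart j) (tStart j + tHalf j)) {K : ℝ} (hK : ∀ s, |deriv (deriv (P.U j)) s| ≤ K)
    (x : UnitAddTorus (Fin 2)) :
    ‖Torus.gradient (torusVorticityTensor (P.field t) 0 1) x‖ ≤ P.rateH j t * K := by
  have hn : ‖EuclideanSpace.single (1 : Fin 2) (1 : ℝ)‖ = 1 := by simp
  rw [P.gradient_vorticity_field_of_mem_H hδ ht x, norm_smul, hn, mul_one,
    norm_neg, norm_mul, Real.norm_eq_abs, Real.norm_eq_abs, abs_of_nonneg (P.rateH_nonneg hγ j t)]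
  exact mul_le_mul_of_nonneg_left (hK _) (P.rateH_nonneg hγ j t)

/-- **Size of `∇Ω̄` on a V half-slot**: `‖∇Ω̄(t, x)‖ ≤ rateV j t · K` whenever `|U_j″| ≤ K`
(`γ ≥ 0`, `δ j > 0`). [cite: ElgindiLissMattingly2025, §1 (u_α = V_α(x₁) e₂; corners of V_α)] -/
theorem norm_gradient_vorticity_field_le_of_mem_V (hγ : 0 ≤ P.γ) {j : ℕ} (hδ : 0 < P.δ j) {t : ℝ}
    (ht : t ∈ Icc (tStart j + tHalf j) (tStart (j + 1))) {K : ℝ} (hK : ∀ s, |deriv (deriv (P.U j)) s| ≤ K)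
    (x : UnitAddTorus (Fin 2)) :
    ‖Torus.gradient (torusVorticityTensor (P.field t) 0 1) x‖ ≤ P.rateV j t * K := by
  have hn : ‖EuclideanSpace.single (0 : Fin 2) (1 : ℝ)‖ = 1 := by simp
  rw [P.gradient_vorticity_field_of_mem_V hδ ht x, norm_smul, hn, mul_one,
    norm_mul, Real.norm_eq_abs, Real.norm_eq_abs, abs_of_nonneg (P.rateV_nonneg hγ j t)]
  exact mul_le_mul_of_nonneg_left (hK _) (P.rateV_nonneg hγ j t)

/-- **The linearised vorticity source on an H half-slot is `rateH · U_j″(x₂) · w₂`**: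
`−⟪w, ∇Ω̄(t, x)⟫ = rateH j t · U_j″(x₂) · w₂` — only the CROSS-STREAM component `w₂ = w x 1` of the
response enters (`δ j > 0`). [cite: ShvydkoyLatushkin2005, §2 (identity curl L_vel v = L curl v, before Remark 1)] -/
theorem neg_inner_gradient_vorticity_field_of_mem_H {j : ℕ} (hδ : 0 < P.δ j) {t : ℝ}
    (ht : t ∈ Icc (tStart j) (tStart j + tHalf j)) (x : UnitAddTorus (Fin 2)) (v : EuclideanSpace ℝ (Fin 2)) :
    -⟪v, Torus.gradient (torusVorticityTensor (P.field t) 0 1) x⟫_ℝ =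
      P.rateH j t * deriv (deriv (P.U j)) (Torus.repr x 1) * v 1 := by
  rw [P.gradient_vorticity_field_of_mem_H hδ ht x, real_inner_smul_right, EuclideanSpace.inner_single_right]
  simp only [one_mul, conj_trivial, neg_mul, neg_neg]

/-- **The linearised vorticity source on a V half-slot is `−rateV · U_j″(x₁) · w₁`**: only the
cross-stream component `w₁ = w x 0` of the response enters (`δ j > 0`). [cite: ShvydkoyLatushkin2005, §2 (identity curl L_vel v = L curl v, before Remark 1)] -/
theorem neg_inner_gradient_vorticity_field_of_mem_V {j : ℕ} (hδ : 0 < P.δ j) {t : ℝ}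
    (ht : t ∈ Icc (tStart j + tHalf j) (tStart (j + 1))) (x : UnitAddTorus (Fin 2)) (v : EuclideanSpace ℝ (Fin 2)) :
    -⟪v, Torus.gradient (torusVorticityTensor (P.field t) 0 1) x⟫_ℝ =
      -(P.rateV j t * deriv (deriv (P.U j)) (Torus.repr x 0) * v 0) := by
  rw [P.gradient_vorticity_field_of_mem_V hδ ht x, real_inner_smul_right, EuclideanSpace.inner_single_right]
  simp only [one_mul, conj_trivial]

/-! ### §2 The response vorticity along one half-slot: maximum principle -/

/-- The cascade carrier is jointly smooth on every window `[a, b]` inside an H half-slot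
(`0 < δ₀`, `0 < d`; `cascadeFieldSmooth` on `[0, 1)` and `tStart j + tHalf j < 1`). [cite: ElgindiLissMattingly2025, Rmk. 1.4 (smooth-in-time pulses)] -/
theorem isSmoothSpaceTimeOn_field_of_subset_H (hδ₀ : 0 < P.δ₀) (hd : 0 < P.d) {j : ℕ} {a b : ℝ}
    (hI : Icc a b ⊆ Icc (tStart j) (tStart j + tHalf j)) : Torus.IsSmoothSpaceTimeOn (Icc a b) P.field := by
  refine (cascadeFieldSmooth P hδ₀ hd).mono fun t ht => ?_
  have h := hI ht
  exact ⟨(tStart_nonneg j).trans h.1, h.2.trans_lt (tStart_add_tHalf_lt_one j)⟩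

/-- The cascade carrier is jointly smooth on every window `[a, b]` inside a V half-slot. [cite: ElgindiLissMattingly2025, Rmk. 1.4 (smooth-in-time pulses)] -/
theorem isSmoothSpaceTimeOn_field_of_subset_V (hδ₀ : 0 < P.δ₀) (hd : 0 < P.d) {j : ℕ} {a b : ℝ}
    (hI : Icc a b ⊆ Icc (tStart j + tHalf j) (tStart (j + 1))) :
    Torus.IsSmoothSpaceTimeOn (Icc a b) P.field := by
  refine (cascadeFieldSmooth P hδ₀ hd).mono fun t ht => ?_
  have h := hI ht
  exact ⟨by linarith [tStart_nonneg j, tHalf_pos j, h.1], h.2.trans_lt (tStart_lt_one (j + 1))⟩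

variable {P}

/-- **Maximum principle for the response vorticity on an H half-slot (forced).** Let `0 < δ₀`, `0 < d`,
`γ ≥ 0`, `ν ≥ 0`, `[a, b] ⊆ [tStart j, tStart j + tHalf j]` (`a < b`), and let `(w, q)` be a classical
solution of the Navier–Stokes equations linearised at the cascade carrier with a force `g`,
`∂ₜw + (ū·∇)w + (w·∇)ū = νΔw − ∇q + g`, `div w = 0`, jointly smooth on `[a, b] × 𝕋²`. If
`|ω_w(a, ·)| ≤ M`, `|U_j″| ≤ K`, `|∂₀g₁ − ∂₁g₀|(τ, ·) ≤ C_g(τ)` and the cross-stream component obeys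
`|w₂(τ, ·)| ≤ M₂(τ)` on `[a, b]` (`C_g`, `M₂` continuous), then for `t ∈ [a, b]` and every `x`:
`|ω_w(t, x)| ≤ M + ∫ₐᵗ (C_g(τ) + rateH j τ · K · M₂(τ)) dτ`. (Planar vorticity maximum principle with the
linearised source `rateH·U_j″(x₂)·w₂ + curl g`.) [cite: Evans2010, §7.1.4 Thm. 8–9 (weak maximum principle with source)] -/
theorem abs_responseVorticity_le_of_mem_H (hδ₀ : 0 < P.δ₀) (hd : 0 < P.d) (hγ : 0 ≤ P.γ) {j : ℕ} {a b : ℝ}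
    (hab : a < b) (hI : Icc a b ⊆ Icc (tStart j) (tStart j + tHalf j)) {ν : ℝ} (hν : 0 ≤ ν)
    {w g : ℝ → UnitAddTorus (Fin 2) → EuclideanSpace ℝ (Fin 2)} {q : ℝ → UnitAddTorus (Fin 2) → ℝ}
    (hw : Torus.IsSmoothSpaceTimeOn (Icc a b) w) (hq : Torus.IsSmoothSpaceTimeOn (Icc a b) q)
    (hwdiv : ∀ t ∈ Icc a b, Torus.IsDivFree (w t))
    (hlin : ∀ t ∈ Icc a b, ∀ x, Torus.timeDerivWithin (Icc a b) w t x + Torus.convect (P.field t) (w t) x +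
      Torus.convect (w t) (P.field t) x = ν • Torus.laplacian (w t) x - Torus.gradient (q t) x + g t x)
    {M : ℝ} (hM : ∀ x, |torusVorticityTensor (w a) 0 1 x| ≤ M)
    {K : ℝ} (hK : ∀ s, |deriv (deriv (P.U j)) s| ≤ K)
    {Cg M₂ : ℝ → ℝ} (hCgc : ContinuousOn Cg (Icc a b)) (hM₂c : ContinuousOn M₂ (Icc a b))
    (hCg : ∀ τ ∈ Icc a b, ∀ y, |Torus.partialDeriv 0 (g τ) y 1 - Torus.partialDeriv 1 (g τ) y 0| ≤ Cg τ)
    (hM₂ : ∀ τ ∈ Icc a b, ∀ y, |w τ y 1| ≤ M₂ τ)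
    {t : ℝ} (ht : t ∈ Icc a b) (x : UnitAddTorus (Fin 2)) :
    |torusVorticityTensor (w t) 0 1 x| ≤ M + ∫ τ in a..t, (Cg τ + P.rateH j τ * K * M₂ τ) := by
  have hu := P.isSmoothSpaceTimeOn_field_of_subset_H hδ₀ hd hI
  have hudiv : ∀ t ∈ Icc a b, Torus.IsDivFree (P.field t) := fun t ht => P.isDivFree_field_of_mem_H (hI ht)
  have hδ : 0 < P.δ j := P.δ_pos hδ₀ hd j
  have hK0 : 0 ≤ K := (abs_nonneg _).trans (hK 0)
  refine linearisedNSForced_abs_vorticity_le_fin_two hu hudiv hw hq hwdiv hlin hab hν hM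
    (hCgc.add (((P.continuous_rateH j).continuousOn.mul continuousOn_const).mul hM₂c)) (fun τ hτ y => ?_) ht x
  have hsrc : (Torus.partialDeriv 0 (g τ) y 1 - Torus.partialDeriv 1 (g τ) y 0) -
      ⟪w τ y, Torus.gradient (torusVorticityTensor (P.field τ) 0 1) y⟫_ℝ =
      (Torus.partialDeriv 0 (g τ) y 1 - Torus.partialDeriv 1 (g τ) y 0) +
        P.rateH j τ * deriv (deriv (P.U j)) (Torus.repr y 1) * w τ y 1 := by
    rw [sub_eq_add_neg, P.neg_inner_gradient_vorticity_field_of_mem_H hδ (hI hτ) y (w τ y)]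
  rw [hsrc]
  refine (abs_add_le _ _).trans (add_le_add (hCg τ hτ y) ?_)
  rw [abs_mul, abs_mul, abs_of_nonneg (P.rateH_nonneg hγ j τ)]
  have hr := P.rateH_nonneg hγ j τ
  calc P.rateH j τ * |deriv (deriv (P.U j)) (Torus.repr y 1)| * |w τ y 1|
      ≤ P.rateH j τ * K * M₂ τ :=
        mul_le_mul (mul_le_mul_of_nonneg_left (hK _) hr) (hM₂ τ hτ y) (abs_nonneg _) (mul_nonneg hr hK0)

/-- **Maximum principle for the response vorticity on a V half-slot (forced)**: as
`abs_responseVorticity_le_of_mem_H` with `[a, b] ⊆ [tStart j + tHalf j, tStart (j+1)]`, the rate `rateV j`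
and the cross-stream component `w₁ = w x 0`:
`|ω_w(t, x)| ≤ M + ∫ₐᵗ (C_g(τ) + rateV j τ · K · M₁(τ)) dτ`. [cite: Evans2010, §7.1.4 Thm. 8–9 (weak maximum principle with source)] -/
theorem abs_responseVorticity_le_of_mem_V (hδ₀ : 0 < P.δ₀) (hd : 0 < P.d) (hγ : 0 ≤ P.γ) {j : ℕ} {a b : ℝ}
    (hab : a < b) (hI : Icc a b ⊆ Icc (tStart j + tHalf j) (tStart (j + 1))) {ν : ℝ} (hν : 0 ≤ ν)
    {w g : ℝ → UnitAddTorus (Fin 2) → EuclideanSpace ℝ (Fin 2)} {q : ℝ → UnitAddTorus (Fin 2) → ℝ}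
    (hw : Torus.IsSmoothSpaceTimeOn (Icc a b) w) (hq : Torus.IsSmoothSpaceTimeOn (Icc a b) q)
    (hwdiv : ∀ t ∈ Icc a b, Torus.IsDivFree (w t))
    (hlin : ∀ t ∈ Icc a b, ∀ x, Torus.timeDerivWithin (Icc a b) w t x + Torus.convect (P.field t) (w t) x +
      Torus.convect (w t) (P.field t) x = ν • Torus.laplacian (w t) x - Torus.gradient (q t) x + g t x)
    {M : ℝ} (hM : ∀ x, |torusVorticityTensor (w a) 0 1 x| ≤ M)
    {K : ℝ} (hK : ∀ s, |deriv (deriv (P.U j)) s| ≤ K)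
    {Cg M₁ : ℝ → ℝ} (hCgc : ContinuousOn Cg (Icc a b)) (hM₁c : ContinuousOn M₁ (Icc a b))
    (hCg : ∀ τ ∈ Icc a b, ∀ y, |Torus.partialDeriv 0 (g τ) y 1 - Torus.partialDeriv 1 (g τ) y 0| ≤ Cg τ)
    (hM₁ : ∀ τ ∈ Icc a b, ∀ y, |w τ y 0| ≤ M₁ τ)
    {t : ℝ} (ht : t ∈ Icc a b) (x : UnitAddTorus (Fin 2)) :
    |torusVorticityTensor (w t) 0 1 x| ≤ M + ∫ τ in a..t, (Cg τ + P.rateV j τ * K * M₁ τ) := by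
  have hu := P.isSmoothSpaceTimeOn_field_of_subset_V hδ₀ hd hI
  have hudiv : ∀ t ∈ Icc a b, Torus.IsDivFree (P.field t) := fun t ht => P.isDivFree_field_of_mem_V (hI ht)
  have hδ : 0 < P.δ j := P.δ_pos hδ₀ hd j
  have hK0 : 0 ≤ K := (abs_nonneg _).trans (hK 0)
  refine linearisedNSForced_abs_vorticity_le_fin_two hu hudiv hw hq hwdiv hlin hab hν hM
    (hCgc.add (((P.continuous_rateV j).continuousOn.mul continuousOn_const).mul hM₁c)) (fun τ hτ y => ?_) ht x
  have hsrc : (Torus.partialDeriv 0 (g τ) y 1 - Torus.partialDeriv 1 (g τ) y 0) -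
      ⟪w τ y, Torus.gradient (torusVorticityTensor (P.field τ) 0 1) y⟫_ℝ =
      (Torus.partialDeriv 0 (g τ) y 1 - Torus.partialDeriv 1 (g τ) y 0) +
        -(P.rateV j τ * deriv (deriv (P.U j)) (Torus.repr y 0) * w τ y 0) := by
    rw [sub_eq_add_neg (Torus.partialDeriv 0 (g τ) y 1 - _),
      P.neg_inner_gradient_vorticity_field_of_mem_V hδ (hI hτ) y (w τ y)]
  rw [hsrc]
  refine (abs_add_le _ _).trans (add_le_add (hCg τ hτ y) ?_)
  rw [abs_neg, abs_mul, abs_mul, abs_of_nonneg (P.rateV_nonneg hγ j τ)]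
  have hr := P.rateV_nonneg hγ j τ
  calc P.rateV j τ * |deriv (deriv (P.U j)) (Torus.repr y 0)| * |w τ y 0|
      ≤ P.rateV j τ * K * M₁ τ :=
        mul_le_mul (mul_le_mul_of_nonneg_left (hK _) hr) (hM₁ τ hτ y) (abs_nonneg _) (mul_nonneg hr hK0)

/-- Partial derivatives of the zero field vanish. [folklore] -/
private theorem partialDeriv_zero_field (i : Fin 2) (y : UnitAddTorus (Fin 2)) :
    Torus.partialDeriv i (0 : UnitAddTorus (Fin 2) → EuclideanSpace ℝ (Fin 2)) y = 0 := by
  change Torus.partialDeriv i (fun _ : UnitAddTorus (Fin 2) => (0 : EuclideanSpace ℝ (Fin 2))) y = 0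
  simp [Torus.partialDeriv, Torus.lineDeriv]

/-- **Maximum principle for the response vorticity on an H half-slot (unforced)**: for a classical
divergence-free solution of `∂ₜw + (ū·∇)w + (w·∇)ū = νΔw − ∇q` on `[a, b] ⊆` H half-slot of phase `j`
(the solution class of `K2PhaseGrowthClassical` / `K2LipschitzGrowthClassical` restricted to the window),
`ν ≥ 0`, `|U_j″| ≤ K`, `|w₂(τ, ·)| ≤ M₂(τ)`:
`|ω_w(t, x)| ≤ sup|ω_w(a, ·)| + K ∫ₐᵗ rateH j τ · M₂(τ) dτ` — with `∫ rateH j = γ` over the half-slot the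
response vorticity grows by at most `γ · K · sup|w₂|` per H pulse, uniformly in `ν`. [cite: Evans2010, §7.1.4 Thm. 8–9 (weak maximum principle with source)] -/
theorem abs_responseVorticity_le_of_mem_H₀ (hδ₀ : 0 < P.δ₀) (hd : 0 < P.d) (hγ : 0 ≤ P.γ) {j : ℕ} {a b : ℝ}
    (hab : a < b) (hI : Icc a b ⊆ Icc (tStart j) (tStart j + tHalf j)) {ν : ℝ} (hν : 0 ≤ ν)
    {w : ℝ → UnitAddTorus (Fin 2) → EuclideanSpace ℝ (Fin 2)} {q : ℝ → UnitAddTorus (Fin 2) → ℝ}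
    (hw : Torus.IsSmoothSpaceTimeOn (Icc a b) w) (hq : Torus.IsSmoothSpaceTimeOn (Icc a b) q)
    (hwdiv : ∀ t ∈ Icc a b, Torus.IsDivFree (w t))
    (hlin : ∀ t ∈ Icc a b, ∀ x, Torus.timeDerivWithin (Icc a b) w t x + Torus.convect (P.field t) (w t) x +
      Torus.convect (w t) (P.field t) x = ν • Torus.laplacian (w t) x - Torus.gradient (q t) x)
    {M : ℝ} (hM : ∀ x, |torusVorticityTensor (w a) 0 1 x| ≤ M)
    {K : ℝ} (hK : ∀ s, |deriv (deriv (P.U j)) s| ≤ K)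
    {M₂ : ℝ → ℝ} (hM₂c : ContinuousOn M₂ (Icc a b)) (hM₂ : ∀ τ ∈ Icc a b, ∀ y, |w τ y 1| ≤ M₂ τ)
    {t : ℝ} (ht : t ∈ Icc a b) (x : UnitAddTorus (Fin 2)) :
    |torusVorticityTensor (w t) 0 1 x| ≤ M + K * ∫ τ in a..t, P.rateH j τ * M₂ τ := by
  have hlin' : ∀ t ∈ Icc a b, ∀ x, Torus.timeDerivWithin (Icc a b) w t x + Torus.convect (P.field t) (w t) x +
      Torus.convect (w t) (P.field t) x = ν • Torus.laplacian (w t) x - Torus.gradient (q t) x +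
        (0 : ℝ → UnitAddTorus (Fin 2) → EuclideanSpace ℝ (Fin 2)) t x := fun t ht x => by
    rw [hlin t ht x, Pi.zero_apply, Pi.zero_apply, add_zero]
  have h := abs_responseVorticity_le_of_mem_H hδ₀ hd hγ hab hI hν hw hq hwdiv hlin' hM hK
    (Cg := fun _ => 0) continuousOn_const hM₂c (fun τ _ y => by
      have e0 : (0 : ℝ → UnitAddTorus (Fin 2) → EuclideanSpace ℝ (Fin 2)) τ =
        (0 : UnitAddTorus (Fin 2) → EuclideanSpace ℝ (Fin 2)) := rfl
      simp only [e0, partialDeriv_zero_field, PiLp.zero_apply, sub_self, abs_zero, le_refl]) hM₂ ht x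
  simp only [zero_add] at h
  calc |torusVorticityTensor (w t) 0 1 x| ≤ M + ∫ τ in a..t, P.rateH j τ * K * M₂ τ := h
    _ = M + K * ∫ τ in a..t, P.rateH j τ * M₂ τ := by
        rw [← intervalIntegral.integral_const_mul]
        congr 1
        refine intervalIntegral.integral_congr fun τ _ => ?_
        ring

/-- **Maximum principle for the response vorticity on a V half-slot (unforced)**:
`|ω_w(t, x)| ≤ sup|ω_w(a, ·)| + K ∫ₐᵗ rateV j τ · M₁(τ) dτ` with `|w₁(τ, ·)| ≤ M₁(τ)` the cross-stream
component. [cite: Evans2010, §7.1.4 Thm. 8–9 (weak maximum principle with source)] -/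
theorem abs_responseVorticity_le_of_mem_V₀ (hδ₀ : 0 < P.δ₀) (hd : 0 < P.d) (hγ : 0 ≤ P.γ) {j : ℕ} {a b : ℝ}
    (hab : a < b) (hI : Icc a b ⊆ Icc (tStart j + tHalf j) (tStart (j + 1))) {ν : ℝ} (hν : 0 ≤ ν)
    {w : ℝ → UnitAddTorus (Fin 2) → EuclideanSpace ℝ (Fin 2)} {q : ℝ → UnitAddTorus (Fin 2) → ℝ}
    (hw : Torus.IsSmoothSpaceTimeOn (Icc a b) w) (hq : Torus.IsSmoothSpaceTimeOn (Icc a b) q)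
    (hwdiv : ∀ t ∈ Icc a b, Torus.IsDivFree (w t))
    (hlin : ∀ t ∈ Icc a b, ∀ x, Torus.timeDerivWithin (Icc a b) w t x + Torus.convect (P.field t) (w t) x +
      Torus.convect (w t) (P.field t) x = ν • Torus.laplacian (w t) x - Torus.gradient (q t) x)
    {M : ℝ} (hM : ∀ x, |torusVorticityTensor (w a) 0 1 x| ≤ M)
    {K : ℝ} (hK : ∀ s, |deriv (deriv (P.U j)) s| ≤ K)
    {M₁ : ℝ → ℝ} (hM₁c : ContinuousOn M₁ (Icc a b)) (hM₁ : ∀ τ ∈ Icc a b, ∀ y, |w τ y 0| ≤ M₁ τ)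
    {t : ℝ} (ht : t ∈ Icc a b) (x : UnitAddTorus (Fin 2)) :
    |torusVorticityTensor (w t) 0 1 x| ≤ M + K * ∫ τ in a..t, P.rateV j τ * M₁ τ := by
  have hlin' : ∀ t ∈ Icc a b, ∀ x, Torus.timeDerivWithin (Icc a b) w t x + Torus.convect (P.field t) (w t) x +
      Torus.convect (w t) (P.field t) x = ν • Torus.laplacian (w t) x - Torus.gradient (q t) x +
        (0 : ℝ → UnitAddTorus (Fin 2) → EuclideanSpace ℝ (Fin 2)) t x := fun t ht x => by
    rw [hlin t ht x, Pi.zero_apply, Pi.zero_apply, add_zero]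
  have h := abs_responseVorticity_le_of_mem_V hδ₀ hd hγ hab hI hν hw hq hwdiv hlin' hM hK
    (Cg := fun _ => 0) continuousOn_const hM₁c (fun τ _ y => by
      have e0 : (0 : ℝ → UnitAddTorus (Fin 2) → EuclideanSpace ℝ (Fin 2)) τ =
        (0 : UnitAddTorus (Fin 2) → EuclideanSpace ℝ (Fin 2)) := rfl
      simp only [e0, partialDeriv_zero_field, PiLp.zero_apply, sub_self, abs_zero, le_refl]) hM₁ ht x
  simp only [zero_add] at h
  calc |torusVorticityTensor (w t) 0 1 x| ≤ M + ∫ τ in a..t, P.rateV j τ * K * M₁ τ := h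
    _ = M + K * ∫ τ in a..t, P.rateV j τ * M₁ τ := by
        rw [← intervalIntegral.integral_const_mul]
        congr 1
        refine intervalIntegral.integral_congr fun τ _ => ?_
        ring

/-! ### §3 The response vorticity along one half-slot: enstrophy -/

/-- **Enstrophy of the response on an H half-slot (unforced)**: for a classical divergence-free solution
of `∂ₜw + (ū·∇)w + (w·∇)ū = νΔw − ∇q` on `[a, b] ⊆` H half-slot of phase `j`, `ν ≥ 0`, `|U_j″| ≤ K`:
`‖ω_w(t)‖_{L²} ≤ ‖ω_w(a)‖_{L²} + K ∫ₐᵗ rateH j τ · ‖w(τ)‖_{L²} dτ` — the response's enstrophy is fed by its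
`L²` size (the K2″ quantity) at rate `K · rateH`, uniformly in `ν` (the pointwise bound
`|rateH·U_j″·w₂| ≤ rateH·K·‖w‖` integrated; `Torus.linearisedNSForced_sqrt_integral_vorticity_sq_le_fin_two`).
[cite: DiPernaLions1989Invent, §II.3] -/
theorem sqrt_integral_responseVorticity_sq_le_of_mem_H₀ (hδ₀ : 0 < P.δ₀) (hd : 0 < P.d) (hγ : 0 ≤ P.γ)
    {j : ℕ} {a b : ℝ} (hab : a < b) (hI : Icc a b ⊆ Icc (tStart j) (tStart j + tHalf j)) {ν : ℝ} (hν : 0 ≤ ν)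
    {w : ℝ → UnitAddTorus (Fin 2) → EuclideanSpace ℝ (Fin 2)} {q : ℝ → UnitAddTorus (Fin 2) → ℝ}
    (hw : Torus.IsSmoothSpaceTimeOn (Icc a b) w) (hq : Torus.IsSmoothSpaceTimeOn (Icc a b) q)
    (hwdiv : ∀ t ∈ Icc a b, Torus.IsDivFree (w t))
    (hlin : ∀ t ∈ Icc a b, ∀ x, Torus.timeDerivWithin (Icc a b) w t x + Torus.convect (P.field t) (w t) x +
      Torus.convect (w t) (P.field t) x = ν • Torus.laplacian (w t) x - Torus.gradient (q t) x)
    {K : ℝ} (hK : ∀ s, |deriv (deriv (P.U j)) s| ≤ K) {t : ℝ} (ht : t ∈ Icc a b) :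
    Real.sqrt (∫ x, torusVorticityTensor (w t) 0 1 x ^ 2) ≤
      Real.sqrt (∫ x, torusVorticityTensor (w a) 0 1 x ^ 2) +
        K * ∫ τ in a..t, P.rateH j τ * Real.sqrt (∫ x, ‖w τ x‖ ^ 2) := by
  have hu := P.isSmoothSpaceTimeOn_field_of_subset_H hδ₀ hd hI
  have hudiv : ∀ t ∈ Icc a b, Torus.IsDivFree (P.field t) := fun t ht => P.isDivFree_field_of_mem_H (hI ht)
  have hδ : 0 < P.δ j := P.δ_pos hδ₀ hd j
  have hK0 : 0 ≤ K := (abs_nonneg _).trans (hK 0)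
  have hlin' : ∀ t ∈ Icc a b, ∀ x, Torus.timeDerivWithin (Icc a b) w t x + Torus.convect (P.field t) (w t) x +
      Torus.convect (w t) (P.field t) x = ν • Torus.laplacian (w t) x - Torus.gradient (q t) x +
        (0 : ℝ → UnitAddTorus (Fin 2) → EuclideanSpace ℝ (Fin 2)) t x := fun t ht x => by
    rw [hlin t ht x, Pi.zero_apply, Pi.zero_apply, add_zero]
  -- the `L²` size of the response is continuous in time
  have hE2 : Torus.IsSmoothSpaceTimeOn (Icc a b) (fun τ x => ‖w τ x‖ ^ 2) := by
    change ContDiffOn ℝ ∞ (fun z => ‖Torus.stLift w z‖ ^ 2) (Icc a b ×ˢ Set.univ)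
    exact hw.norm_sq ℝ
  have hGc : ContinuousOn (fun τ => P.rateH j τ * K * Real.sqrt (∫ x, ‖w τ x‖ ^ 2)) (Icc a b) :=
    ((P.continuous_rateH j).continuousOn.mul continuousOn_const).mul
      (hE2.continuousOn_integral (convex_Icc a b)).sqrt
  have hG0 : ∀ τ ∈ Icc a b, 0 ≤ P.rateH j τ * K * Real.sqrt (∫ x, ‖w τ x‖ ^ 2) := fun τ _ =>
    mul_nonneg (mul_nonneg (P.rateH_nonneg hγ j τ) hK0) (Real.sqrt_nonneg _)
  have h := linearisedNSForced_sqrt_integral_vorticity_sq_le_fin_two hu hudiv hw hq hwdiv hlin' hab hν hGc hG0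
    (fun τ hτ => ?_) ht
  · calc Real.sqrt (∫ x, torusVorticityTensor (w t) 0 1 x ^ 2)
        ≤ Real.sqrt (∫ x, torusVorticityTensor (w a) 0 1 x ^ 2) +
          ∫ τ in a..t, P.rateH j τ * K * Real.sqrt (∫ x, ‖w τ x‖ ^ 2) := h
      _ = Real.sqrt (∫ x, torusVorticityTensor (w a) 0 1 x ^ 2) +
          K * ∫ τ in a..t, P.rateH j τ * Real.sqrt (∫ x, ‖w τ x‖ ^ 2) := by
          rw [← intervalIntegral.integral_const_mul]
          congr 1
          refine intervalIntegral.integral_congr fun τ _ => ?_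
          ring
  · -- pointwise: `source = rateH·U″(x₂)·w₂`, `|source| ≤ rateH·K·‖w‖`
    have hwτ : Torus.IsSmooth (w τ) := hw.isSmooth_slice hτ
    have e0 : (0 : ℝ → UnitAddTorus (Fin 2) → EuclideanSpace ℝ (Fin 2)) τ =
        (0 : UnitAddTorus (Fin 2) → EuclideanSpace ℝ (Fin 2)) := rfl
    have hsrc : ∀ y, (Torus.partialDeriv 0 ((0 : ℝ → UnitAddTorus (Fin 2) → EuclideanSpace ℝ (Fin 2)) τ) y 1 -
        Torus.partialDeriv 1 ((0 : ℝ → UnitAddTorus (Fin 2) → EuclideanSpace ℝ (Fin 2)) τ) y 0) -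
        ⟪w τ y, Torus.gradient (torusVorticityTensor (P.field τ) 0 1) y⟫_ℝ =
        P.rateH j τ * deriv (deriv (P.U j)) (Torus.repr y 1) * w τ y 1 := by
      intro y
      rw [e0, partialDeriv_zero_field, partialDeriv_zero_field, PiLp.zero_apply, PiLp.zero_apply, sub_self,
        zero_sub, P.neg_inner_gradient_vorticity_field_of_mem_H hδ (hI hτ) y (w τ y)]
    simp_rw [hsrc]
    have hpt : ∀ y, (P.rateH j τ * deriv (deriv (P.U j)) (Torus.repr y 1) * w τ y 1) ^ 2 ≤
        (P.rateH j τ * K) ^ 2 * ‖w τ y‖ ^ 2 := by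
      intro y
      have h1 : |P.rateH j τ * deriv (deriv (P.U j)) (Torus.repr y 1) * w τ y 1| ≤
          P.rateH j τ * K * ‖w τ y‖ := by
        rw [abs_mul, abs_mul, abs_of_nonneg (P.rateH_nonneg hγ j τ)]
        have hr := P.rateH_nonneg hγ j τ
        have hcomp : |w τ y 1| ≤ ‖w τ y‖ := by
          simpa using PiLp.norm_apply_le (w τ y) 1
        exact mul_le_mul (mul_le_mul_of_nonneg_left (hK _) hr) hcomp (abs_nonneg _) (mul_nonneg hr hK0)
      calc (P.rateH j τ * deriv (deriv (P.U j)) (Torus.repr y 1) * w τ y 1) ^ 2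
          = |P.rateH j τ * deriv (deriv (P.U j)) (Torus.repr y 1) * w τ y 1| ^ 2 := (sq_abs _).symm
        _ ≤ (P.rateH j τ * K * ‖w τ y‖) ^ 2 := pow_le_pow_left₀ (abs_nonneg _) h1 2
        _ = (P.rateH j τ * K) ^ 2 * ‖w τ y‖ ^ 2 := by ring
    have hint : Integrable (fun y => (P.rateH j τ * K) ^ 2 * ‖w τ y‖ ^ 2)
        (volume : Measure (UnitAddTorus (Fin 2))) :=
      ((hwτ.continuous.norm.pow 2).integrable_unitAddTorus).const_mul _
    have hcont : Continuous fun y => P.rateH j τ * deriv (deriv (P.U j)) (Torus.repr y 1) * w τ y 1 := by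
      have hc1 : Continuous fun y : UnitAddTorus (Fin 2) => deriv (deriv (P.U j)) (Torus.repr y 1) :=
        (isSmooth_coordFun (P.deriv_deriv_U_periodic j)
          ((contDiff_infty_iff_deriv.1 (P.contDiff_deriv_U hδ (n := ⊤))).2) 1).continuous
      exact (continuous_const.mul hc1).mul ((hwτ.apply 1).continuous)
    have hle : ∫ y, (P.rateH j τ * deriv (deriv (P.U j)) (Torus.repr y 1) * w τ y 1) ^ 2 ≤
        ∫ y, (P.rateH j τ * K) ^ 2 * ‖w τ y‖ ^ 2 :=
      integral_mono ((hcont.pow 2).integrable_unitAddTorus) hint hpt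
    rw [integral_const_mul] at hle
    calc Real.sqrt (∫ y, (P.rateH j τ * deriv (deriv (P.U j)) (Torus.repr y 1) * w τ y 1) ^ 2)
        ≤ Real.sqrt ((P.rateH j τ * K) ^ 2 * ∫ y, ‖w τ y‖ ^ 2) := Real.sqrt_le_sqrt hle
      _ = P.rateH j τ * K * Real.sqrt (∫ y, ‖w τ y‖ ^ 2) := by
          rw [Real.sqrt_mul (sq_nonneg _), Real.sqrt_sq (mul_nonneg (P.rateH_nonneg hγ j τ) hK0)]

/-- **Enstrophy of the response on a V half-slot (unforced)**: for a classical divergence-free solution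
of `∂ₜw + (ū·∇)w + (w·∇)ū = νΔw − ∇q` on `[a, b] ⊆` V half-slot of phase `j`, `ν ≥ 0`, `|U_j″| ≤ K`:
`‖ω_w(t)‖_{L²} ≤ ‖ω_w(a)‖_{L²} + K ∫ₐᵗ rateV j τ · ‖w(τ)‖_{L²} dτ` — the response's enstrophy is fed by its
`L²` size (the K2″ quantity) at rate `K · rateV`, uniformly in `ν` (the pointwise bound
`|rateV·U_j″·w₁| ≤ rateV·K·‖w‖` integrated; `Torus.linearisedNSForced_sqrt_integral_vorticity_sq_le_fin_two`).
[cite: DiPernaLions1989Invent, §II.3] -/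
theorem sqrt_integral_responseVorticity_sq_le_of_mem_V₀ (hδ₀ : 0 < P.δ₀) (hd : 0 < P.d) (hγ : 0 ≤ P.γ)
    {j : ℕ} {a b : ℝ} (hab : a < b) (hI : Icc a b ⊆ Icc (tStart j + tHalf j) (tStart (j + 1))) {ν : ℝ} (hν : 0 ≤ ν)
    {w : ℝ → UnitAddTorus (Fin 2) → EuclideanSpace ℝ (Fin 2)} {q : ℝ → UnitAddTorus (Fin 2) → ℝ}
    (hw : Torus.IsSmoothSpaceTimeOn (Icc a b) w) (hq : Torus.IsSmoothSpaceTimeOn (Icc a b) q)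
    (hwdiv : ∀ t ∈ Icc a b, Torus.IsDivFree (w t))
    (hlin : ∀ t ∈ Icc a b, ∀ x, Torus.timeDerivWithin (Icc a b) w t x + Torus.convect (P.field t) (w t) x +
      Torus.convect (w t) (P.field t) x = ν • Torus.laplacian (w t) x - Torus.gradient (q t) x)
    {K : ℝ} (hK : ∀ s, |deriv (deriv (P.U j)) s| ≤ K) {t : ℝ} (ht : t ∈ Icc a b) :
    Real.sqrt (∫ x, torusVorticityTensor (w t) 0 1 x ^ 2) ≤
      Real.sqrt (∫ x, torusVorticityTensor (w a) 0 1 x ^ 2) +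
        K * ∫ τ in a..t, P.rateV j τ * Real.sqrt (∫ x, ‖w τ x‖ ^ 2) := by
  have hu := P.isSmoothSpaceTimeOn_field_of_subset_V hδ₀ hd hI
  have hudiv : ∀ t ∈ Icc a b, Torus.IsDivFree (P.field t) := fun t ht => P.isDivFree_field_of_mem_V (hI ht)
  have hδ : 0 < P.δ j := P.δ_pos hδ₀ hd j
  have hK0 : 0 ≤ K := (abs_nonneg _).trans (hK 0)
  have hlin' : ∀ t ∈ Icc a b, ∀ x, Torus.timeDerivWithin (Icc a b) w t x + Torus.convect (P.field t) (w t) x +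
      Torus.convect (w t) (P.field t) x = ν • Torus.laplacian (w t) x - Torus.gradient (q t) x +
        (0 : ℝ → UnitAddTorus (Fin 2) → EuclideanSpace ℝ (Fin 2)) t x := fun t ht x => by
    rw [hlin t ht x, Pi.zero_apply, Pi.zero_apply, add_zero]
  -- the `L²` size of the response is continuous in time
  have hE2 : Torus.IsSmoothSpaceTimeOn (Icc a b) (fun τ x => ‖w τ x‖ ^ 2) := by
    change ContDiffOn ℝ ∞ (fun z => ‖Torus.stLift w z‖ ^ 2) (Icc a b ×ˢ Set.univ)
    exact hw.norm_sq ℝ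
  have hGc : ContinuousOn (fun τ => P.rateV j τ * K * Real.sqrt (∫ x, ‖w τ x‖ ^ 2)) (Icc a b) :=
    ((P.continuous_rateV j).continuousOn.mul continuousOn_const).mul
      (hE2.continuousOn_integral (convex_Icc a b)).sqrt
  have hG0 : ∀ τ ∈ Icc a b, 0 ≤ P.rateV j τ * K * Real.sqrt (∫ x, ‖w τ x‖ ^ 2) := fun τ _ =>
    mul_nonneg (mul_nonneg (P.rateV_nonneg hγ j τ) hK0) (Real.sqrt_nonneg _)
  have h := linearisedNSForced_sqrt_integral_vorticity_sq_le_fin_two hu hudiv hw hq hwdiv hlin' hab hν hGc hG0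
    (fun τ hτ => ?_) ht
  · calc Real.sqrt (∫ x, torusVorticityTensor (w t) 0 1 x ^ 2)
        ≤ Real.sqrt (∫ x, torusVorticityTensor (w a) 0 1 x ^ 2) +
          ∫ τ in a..t, P.rateV j τ * K * Real.sqrt (∫ x, ‖w τ x‖ ^ 2) := h
      _ = Real.sqrt (∫ x, torusVorticityTensor (w a) 0 1 x ^ 2) +
          K * ∫ τ in a..t, P.rateV j τ * Real.sqrt (∫ x, ‖w τ x‖ ^ 2) := by
          rw [← intervalIntegral.integral_const_mul]
          congr 1
          refine intervalIntegral.integral_congr fun τ _ => ?_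
          ring
  · -- pointwise: `source = −rateV·U″(x₁)·w₁`, `|source| ≤ rateV·K·‖w‖`
    have hwτ : Torus.IsSmooth (w τ) := hw.isSmooth_slice hτ
    have e0 : (0 : ℝ → UnitAddTorus (Fin 2) → EuclideanSpace ℝ (Fin 2)) τ =
        (0 : UnitAddTorus (Fin 2) → EuclideanSpace ℝ (Fin 2)) := rfl
    have hsrc : ∀ y, (Torus.partialDeriv 0 ((0 : ℝ → UnitAddTorus (Fin 2) → EuclideanSpace ℝ (Fin 2)) τ) y 1 -
        Torus.partialDeriv 1 ((0 : ℝ → UnitAddTorus (Fin 2) → EuclideanSpace ℝ (Fin 2)) τ) y 0) -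
        ⟪w τ y, Torus.gradient (torusVorticityTensor (P.field τ) 0 1) y⟫_ℝ =
        -(P.rateV j τ * deriv (deriv (P.U j)) (Torus.repr y 0) * w τ y 0) := by
      intro y
      rw [e0, partialDeriv_zero_field, partialDeriv_zero_field, PiLp.zero_apply, PiLp.zero_apply, sub_self,
        zero_sub, P.neg_inner_gradient_vorticity_field_of_mem_V hδ (hI hτ) y (w τ y)]
    simp_rw [hsrc]
    have hpt : ∀ y, (-(P.rateV j τ * deriv (deriv (P.U j)) (Torus.repr y 0) * w τ y 0)) ^ 2 ≤
        (P.rateV j τ * K) ^ 2 * ‖w τ y‖ ^ 2 := by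
      intro y
      have h1 : |P.rateV j τ * deriv (deriv (P.U j)) (Torus.repr y 0) * w τ y 0| ≤
          P.rateV j τ * K * ‖w τ y‖ := by
        rw [abs_mul, abs_mul, abs_of_nonneg (P.rateV_nonneg hγ j τ)]
        have hr := P.rateV_nonneg hγ j τ
        have hcomp : |w τ y 0| ≤ ‖w τ y‖ := by
          simpa using PiLp.norm_apply_le (w τ y) 0
        exact mul_le_mul (mul_le_mul_of_nonneg_left (hK _) hr) hcomp (abs_nonneg _) (mul_nonneg hr hK0)
      calc (-(P.rateV j τ * deriv (deriv (P.U j)) (Torus.repr y 0) * w τ y 0)) ^ 2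
          = |P.rateV j τ * deriv (deriv (P.U j)) (Torus.repr y 0) * w τ y 0| ^ 2 := by
            rw [neg_sq, sq_abs]
        _ ≤ (P.rateV j τ * K * ‖w τ y‖) ^ 2 := pow_le_pow_left₀ (abs_nonneg _) h1 2
        _ = (P.rateV j τ * K) ^ 2 * ‖w τ y‖ ^ 2 := by ring
    have hint : Integrable (fun y => (P.rateV j τ * K) ^ 2 * ‖w τ y‖ ^ 2)
        (volume : Measure (UnitAddTorus (Fin 2))) :=
      ((hwτ.continuous.norm.pow 2).integrable_unitAddTorus).const_mul _
    have hcont : Continuous fun y => -(P.rateV j τ * deriv (deriv (P.U j)) (Torus.repr y 0) * w τ y 0) := by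
      have hc1 : Continuous fun y : UnitAddTorus (Fin 2) => deriv (deriv (P.U j)) (Torus.repr y 0) :=
        (isSmooth_coordFun (P.deriv_deriv_U_periodic j)
          ((contDiff_infty_iff_deriv.1 (P.contDiff_deriv_U hδ (n := ⊤))).2) 0).continuous
      exact ((continuous_const.mul hc1).mul ((hwτ.apply 0).continuous)).neg
    have hle : ∫ y, (-(P.rateV j τ * deriv (deriv (P.U j)) (Torus.repr y 0) * w τ y 0)) ^ 2 ≤
        ∫ y, (P.rateV j τ * K) ^ 2 * ‖w τ y‖ ^ 2 :=
      integral_mono ((hcont.pow 2).integrable_unitAddTorus) hint hpt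
    rw [integral_const_mul] at hle
    calc Real.sqrt (∫ y, (-(P.rateV j τ * deriv (deriv (P.U j)) (Torus.repr y 0) * w τ y 0)) ^ 2)
        ≤ Real.sqrt ((P.rateV j τ * K) ^ 2 * ∫ y, ‖w τ y‖ ^ 2) := Real.sqrt_le_sqrt hle
      _ = P.rateV j τ * K * Real.sqrt (∫ y, ‖w τ y‖ ^ 2) := by
          rw [Real.sqrt_mul (sq_nonneg _), Real.sqrt_sq (mul_nonneg (P.rateV_nonneg hγ j τ) hK0)]

end CascadeParams

end Literature.Analysis.FluidPDE.SawtoothCascade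

end
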